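import Summits.Ventures.HodgeRepro.CMHodgeGalois
import Summits.Ventures.HodgeRepro.Night1ProductWeilSpace

/-!
# The `ℚ`-structure of the Weil space in the model: for a Galois CM field `K` the rational Weil classes
`Σ_σ σ(f) e_{line σ}`, `f ∈ K`, form a `ℚ`-form of the Weil space — their `ℂ`-span is the whole Weil
space (Dedekind: `ℂ ⊗_ℚ K ≅ ℂ^{Hom(K, ℂ)}`) and `f ↦ class` is injective and `ℚ`-linear

Blind re-derivation cell `pub-hodge-repro`, seat `night-1` (gen 4).  Imports typer-2's `CMHodgeGalois`
(p341193: `galEquivAlgHom K φ₀ : Gal(K/ℚ) ≃ Hom_ℚ(K, ℂ)`, `g ↦ φ₀ ∘ g`, on `CMHodge` p338037: the splitting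
`splitEquiv : ℂ ⊗[ℚ] K ≃ₐ[ℂ] (Hom(K, ℂ) → ℂ)`, `c ⊗ u ↦ (σ ↦ c σ(u))`, Deligne Ex. 3.7) and night-1's
`Night1ProductWeilSpace` (the Weil space `weilSpaceProd G k e = span {weilWedgeProd e g : g ∈ G}` of the
full corner product on the `G`-set `ι × G`, here `G = Gal(K/ℚ)`).

Milne 2020 §2.1 (paper:arxiv-2010.08857 p0004:L3–10): `W_E(A) := ∧^d_E H¹(A, ℚ)` is a one-dimensional
`E`-space inside `H^d(A, ℚ)`.  With `H¹(B, ℚ) = K^ι` for the corner product `B = ∏_i A_{T i}` (one copy of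
`K` per factor; this identification is the CM-type bookkeeping of the route, not modelled here), a rational
Weil class is `f · (v_1 ∧_K ⋯ ∧_K v_{2k})`, and under `K ⊗_ℚ ℂ = ∏_σ ℂ` its image in `⋀^{2k} ℂ^{ι × G}` is
`Σ_σ σ(f) e_{line σ}` — the *rational Weil class* `ratWeil φ₀ e f` of this file (`σ = σ_g = φ₀ ∘ g`):

* `lineComb φ₀ e : (Hom(K, ℂ) → ℂ) →ₗ[ℂ] ⋀^{2k} ℂ^{ι × G}`, `v ↦ Σ_g v(σ_g) • e_g`, with
  `lineComb_single` (`δ_{σ_g} ↦ e_g`), `range_lineComb` (`= weilSpaceProd`) and `lineComb_injective`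
  (`k ≥ 1`): `ℂ^{Hom(K, ℂ)} ≅ W`, hence `ℂ ⊗_ℚ K ≅ W` through `splitEquiv` — the Weil space is a free
  `K ⊗ ℂ`-module of rank one generated by `ratWeil 1 = Σ_g e_g` (`ratWeil_one`) — made literal by
  **`weilEquiv : ℂ ⊗[ℚ] K ≃ₗ[ℂ] weilSpaceProd G k e`**, `c ⊗ f ↦ c • ratWeil f` (`coe_weilEquiv_tmul`);
* `ratWeil φ₀ e f := Σ_g φ₀(g f) • weilWedgeProd e g` (`ratWeil_eq_lineComb`: `= lineComb (σ ↦ σ f)`);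
* **`span_ratWeil`** — `span ℂ {ratWeil φ₀ e f : f ∈ K} = weilSpaceProd G k e`: the rational Weil classes
  span the Weil space over `ℂ` (through `splitEquiv`: `ℂ ⊗ K` is spanned by the `1 ⊗ f`);
* `ratWeil_add` / `ratWeil_smul` (`ℚ`-linear in `f`) and **`ratWeil_injective`** (`k ≥ 1`, through the
  dual functionals `lineDual`: `lineDual_ratWeil` reads off the coefficient `φ₀(g f)`): `K → W`,
  `f ↦ ratWeil f`, is an injective `ℚ`-linear map whose `ℂ`-span is the Weil space — a `ℚ`-form of
  dimension `[K : ℚ] = |G|`;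
* `fieldAct φ₀ e f` — the action of `f ∈ K` through `K ⊗ ℂ = ∏_σ ℂ` (`σ_g(f)` on the `g`-line,
  `fieldAct_weilWedgeProd`), with `fieldAct_ratWeil : fieldAct f (ratWeil f') = ratWeil (f f')`: the rational
  Weil classes are the `K`-line `K · ratWeil 1`;
* `galProd_ratWeil` — the model's Galois action `galProd k h` carries `ratWeil φ₀ e f` to
  `ratWeil (φ₀ ∘ h⁻¹) e f`: it changes the base embedding (the action on the CM-algebra side
  `K ⊗ ℂ = ∏_σ ℂ`, permuting the factors), not `f`.

Nothing geometric is built: the `ℚ`-structure is the one `H¹(B, ℚ) = K^ι` induces on coordinate wedges of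
the finite `G`-set `ι × G`.  Nothing here says anything about the status of the Hodge conjecture for CM
abelian varieties, which is NOT proved.
-/

set_option autoImplicit false

open Finset Module
open scoped TensorProduct Classical

namespace HodgeRepro.RouteC

open CMHodge CMHodgeOn

variable (K : Type*) [Field K] [NumberField K] [IsGalois ℚ K] (φ₀ : K →+* ℂ)
variable {ι : Type*} [Fintype ι] [DecidableEq ι]

/-- From a function on the embeddings to the Weil space: `v ↦ Σ_g v(σ_g) • e_g`, `σ_g = φ₀ ∘ g`. -/
noncomputable def lineComb {k : ℕ} (e : Fin (2 * k) ≃ ι) :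
    ((K →ₐ[ℚ] ℂ) → ℂ) →ₗ[ℂ] ⋀[ℂ]^(2 * k) ((ι × (K ≃ₐ[ℚ] K)) → ℂ) :=
  ∑ g : K ≃ₐ[ℚ] K,
    (LinearMap.proj (galEquivAlgHom K φ₀ g) : ((K →ₐ[ℚ] ℂ) → ℂ) →ₗ[ℂ] ℂ).smulRight (weilWedgeProd e g)

omit [Fintype ι] in
/-- `lineComb φ₀ e v = Σ_g v(σ_g) • e_g`. -/
theorem lineComb_apply {k : ℕ} (e : Fin (2 * k) ≃ ι) (v : (K →ₐ[ℚ] ℂ) → ℂ) :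
    lineComb K φ₀ e v = ∑ g : K ≃ₐ[ℚ] K, v (galEquivAlgHom K φ₀ g) • weilWedgeProd e g := by
  simp only [lineComb, LinearMap.sum_apply, LinearMap.smulRight_apply, LinearMap.proj_apply]

omit [Fintype ι] in
/-- The indicator function of `σ_g` goes to the `g`-line. -/
theorem lineComb_single {k : ℕ} (e : Fin (2 * k) ≃ ι) (g : K ≃ₐ[ℚ] K) :
    lineComb K φ₀ e (Pi.single (galEquivAlgHom K φ₀ g) 1) = weilWedgeProd e g := by
  rw [lineComb_apply, Finset.sum_eq_single g]
  · simp
  · intro g' _ hg'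
    rw [Pi.single_apply, if_neg (fun h => hg' ((galEquivAlgHom K φ₀).injective h)), zero_smul]
  · intro h
    exact absurd (Finset.mem_univ g) h

omit [Fintype ι] in
/-- Every value of `lineComb` lies in the Weil space. -/
theorem lineComb_mem_weilSpaceProd {k : ℕ} (e : Fin (2 * k) ≃ ι) (v : (K →ₐ[ℚ] ℂ) → ℂ) :
    lineComb K φ₀ e v ∈ weilSpaceProd (K ≃ₐ[ℚ] K) k e := by
  rw [lineComb_apply]
  exact Submodule.sum_mem _ fun g _ => Submodule.smul_mem _ _ (weilWedgeProd_mem_weilSpaceProd k e g)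

omit [Fintype ι] in
/-- **The range of `lineComb` is the Weil space.** -/
theorem range_lineComb {k : ℕ} (e : Fin (2 * k) ≃ ι) :
    LinearMap.range (lineComb K φ₀ e) = weilSpaceProd (K ≃ₐ[ℚ] K) k e := by
  apply le_antisymm
  · rintro _ ⟨v, rfl⟩
    exact lineComb_mem_weilSpaceProd K φ₀ e v
  · rw [weilSpaceProd, Submodule.span_le]
    rintro _ ⟨g, rfl⟩
    exact ⟨Pi.single (galEquivAlgHom K φ₀ g) 1, lineComb_single K φ₀ e g⟩

omit [Fintype ι] in
/-- The coefficient of the `g`-line in `lineComb φ₀ e v` is `v(σ_g)` (`k ≥ 1`). -/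
theorem lineDual_lineComb {k : ℕ} (hk : 0 < k) (e : Fin (2 * k) ≃ ι) (v : (K →ₐ[ℚ] ℂ) → ℂ)
    (g : K ≃ₐ[ℚ] K) : lineDual e g (lineComb K φ₀ e v) = v (galEquivAlgHom K φ₀ g) := by
  rw [lineComb_apply, map_sum, Finset.sum_eq_single g]
  · rw [map_smul, lineDual_weilWedgeProd_self, smul_eq_mul, mul_one]
  · intro g' _ hg'
    rw [map_smul, lineDual_weilWedgeProd_of_ne hk e (Ne.symm hg'), smul_zero]
  · intro h
    exact absurd (Finset.mem_univ g) h

omit [Fintype ι] in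
/-- **`lineComb` is injective** (`k ≥ 1`): with `range_lineComb`, `ℂ^{Hom(K, ℂ)} ≅ W` — so, through
`splitEquiv`, `ℂ ⊗_ℚ K ≅ W`: the Weil space is a free `K ⊗ ℂ`-module of rank one (Milne's «one-dimensional
`E`-vector space» on the kernel), generated by `lineComb (1) = Σ_g e_g = ratWeil 1`. -/
theorem lineComb_injective {k : ℕ} (hk : 0 < k) (e : Fin (2 * k) ≃ ι) :
    Function.Injective (lineComb K φ₀ e) := by
  intro v v' h
  funext σ
  obtain ⟨g, rfl⟩ := (galEquivAlgHom K φ₀).surjective σ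
  exact (lineDual_lineComb K φ₀ hk e v g).symm.trans
    ((congrArg (lineDual e g) h).trans (lineDual_lineComb K φ₀ hk e v' g))

/-! ### The rational Weil classes -/

/-- **The rational Weil class of `f ∈ K`**: `Σ_g σ_g(f) • e_g = Σ_g φ₀(g f) • weilWedgeProd e g` — the image
of `f · (v_1 ∧_K ⋯ ∧_K v_{2k}) ∈ W_K(B)` under `K ⊗ ℂ = ∏_σ ℂ`. -/
noncomputable def ratWeil {k : ℕ} (e : Fin (2 * k) ≃ ι) (f : K) :
    ⋀[ℂ]^(2 * k) ((ι × (K ≃ₐ[ℚ] K)) → ℂ) :=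
  ∑ g : K ≃ₐ[ℚ] K, (φ₀ (g f)) • weilWedgeProd e g

omit [Fintype ι] in
/-- `ratWeil φ₀ e f = lineComb φ₀ e (σ ↦ σ f)`. -/
theorem ratWeil_eq_lineComb {k : ℕ} (e : Fin (2 * k) ≃ ι) (f : K) :
    ratWeil K φ₀ e f = lineComb K φ₀ e fun σ => σ f := by
  rw [lineComb_apply, ratWeil]
  rfl

omit [Fintype ι] in
/-- `ratWeil` is the composite of `lineComb` with the splitting on `1 ⊗ f`. -/
theorem ratWeil_eq_lineComb_splitEquiv {k : ℕ} (e : Fin (2 * k) ≃ ι) (f : K) :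
    ratWeil K φ₀ e f = lineComb K φ₀ e (splitEquiv K ((1 : ℂ) ⊗ₜ[ℚ] f)) := by
  rw [ratWeil_eq_lineComb]
  congr 1
  funext σ
  rw [splitEquiv_tmul, one_mul]

omit [Fintype ι] in
/-- The rational Weil classes lie in the Weil space. -/
theorem ratWeil_mem_weilSpaceProd {k : ℕ} (e : Fin (2 * k) ≃ ι) (f : K) :
    ratWeil K φ₀ e f ∈ weilSpaceProd (K ≃ₐ[ℚ] K) k e := by
  rw [ratWeil_eq_lineComb]
  exact lineComb_mem_weilSpaceProd K φ₀ e _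

/-- `ℂ ⊗[ℚ] K` is spanned over `ℂ` by the pure tensors `1 ⊗ f`. -/
theorem span_one_tmul_eq_top :
    Submodule.span ℂ (Set.range fun f : K => ((1 : ℂ) ⊗ₜ[ℚ] f : ℂ ⊗[ℚ] K)) = ⊤ := by
  rw [eq_top_iff, ← (Algebra.TensorProduct.basis ℂ (Module.finBasis ℚ K)).span_eq]
  refine Submodule.span_mono ?_
  rintro _ ⟨i, rfl⟩
  exact ⟨Module.finBasis ℚ K i, (Algebra.TensorProduct.basis_apply _ i).symm⟩

omit [Fintype ι] in
/-- **The rational Weil classes span the Weil space over `ℂ`** (Dedekind: `ℂ ⊗_ℚ K ≅ ℂ^{Hom(K, ℂ)}`, so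
every indicator `δ_{σ_g}`, hence every line `e_g`, is a `ℂ`-combination of the `(σ(f))_σ`). -/
theorem span_ratWeil {k : ℕ} (e : Fin (2 * k) ≃ ι) :
    Submodule.span ℂ (Set.range (ratWeil K φ₀ e)) = weilSpaceProd (K ≃ₐ[ℚ] K) k e := by
  apply le_antisymm
  · rw [Submodule.span_le]
    rintro _ ⟨f, rfl⟩
    exact ratWeil_mem_weilSpaceProd K φ₀ e f
  · rw [← range_lineComb K φ₀ e]
    rintro _ ⟨v, rfl⟩
    -- `v = splitEquiv t` with `t ∈ ℂ ⊗ K = span {1 ⊗ f}`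
    set L : (ℂ ⊗[ℚ] K) →ₗ[ℂ] ⋀[ℂ]^(2 * k) ((ι × (K ≃ₐ[ℚ] K)) → ℂ) :=
      lineComb K φ₀ e ∘ₗ (splitEquiv K).toLinearMap with hL
    have hv : lineComb K φ₀ e v = L ((splitEquiv K).symm v) := by
      simp [hL]
    rw [hv]
    have ht : (splitEquiv K).symm v ∈
        Submodule.span ℂ (Set.range fun f : K => ((1 : ℂ) ⊗ₜ[ℚ] f : ℂ ⊗[ℚ] K)) := by
      rw [span_one_tmul_eq_top]
      exact Submodule.mem_top
    have hmap := Submodule.mem_map_of_mem (f := L) ht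
    rw [Submodule.map_span] at hmap
    refine Submodule.span_mono ?_ hmap
    rintro _ ⟨_, ⟨f, rfl⟩, rfl⟩
    refine ⟨f, ?_⟩
    rw [ratWeil_eq_lineComb_splitEquiv]
    simp [hL]

/-! ### `ℂ ⊗_ℚ K ≅ W`: the Weil space is free of rank one over `K ⊗ ℂ` -/

omit [IsGalois ℚ K] [Fintype ι] in
/-- The rational class of `1 ∈ K` is the sum of the lines: the generator `Σ_g e_g`. -/
theorem ratWeil_one {k : ℕ} (e : Fin (2 * k) ≃ ι) :
    ratWeil K φ₀ e 1 = ∑ g : K ≃ₐ[ℚ] K, weilWedgeProd e g := by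
  simp [ratWeil]

omit [Fintype ι] in
/-- The composite `ℂ ⊗_ℚ K → W`, `c ⊗ f ↦ c • ratWeil f` (`lineComb` after the splitting), is injective
(`k ≥ 1`). -/
theorem lineComb_comp_splitEquiv_injective {k : ℕ} (hk : 0 < k) (e : Fin (2 * k) ≃ ι) :
    Function.Injective (lineComb K φ₀ e ∘ₗ (splitEquiv K).toLinearMap) :=
  (lineComb_injective K φ₀ hk e).comp (splitEquiv K).injective

omit [Fintype ι] in
/-- Its range is the Weil space. -/
theorem range_lineComb_comp_splitEquiv {k : ℕ} (e : Fin (2 * k) ≃ ι) :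
    LinearMap.range (lineComb K φ₀ e ∘ₗ (splitEquiv K).toLinearMap) = weilSpaceProd (K ≃ₐ[ℚ] K) k e := by
  have hs : LinearMap.range (splitEquiv K).toLinearMap = ⊤ :=
    LinearMap.range_eq_top.2 (splitEquiv K).surjective
  rw [LinearMap.range_comp, hs, Submodule.map_top, range_lineComb]

omit [Fintype ι] in
/-- **`ℂ ⊗_ℚ K ≅ W_K(B) ⊗ ℂ`** (`k ≥ 1`): the `ℂ`-linear isomorphism `c ⊗ f ↦ c • ratWeil f` onto the Weil
space — the model's form of «`W_E(A)` is a one-dimensional `E`-vector space» (Milne 2020 §2.1): a free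
`K ⊗ ℂ`-module of rank one, generated by `ratWeil 1 = Σ_g e_g`. -/
noncomputable def weilEquiv {k : ℕ} (hk : 0 < k) (e : Fin (2 * k) ≃ ι) :
    (ℂ ⊗[ℚ] K) ≃ₗ[ℂ] weilSpaceProd (K ≃ₐ[ℚ] K) k e :=
  (LinearEquiv.ofInjective _ (lineComb_comp_splitEquiv_injective K φ₀ hk e)).trans
    (LinearEquiv.ofEq _ _ (range_lineComb_comp_splitEquiv K φ₀ e))

omit [Fintype ι] in
/-- `weilEquiv (c ⊗ f) = c • ratWeil f`. -/
theorem coe_weilEquiv_tmul {k : ℕ} (hk : 0 < k) (e : Fin (2 * k) ≃ ι) (c : ℂ) (f : K) :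
    (weilEquiv K φ₀ hk e (c ⊗ₜ[ℚ] f) : ⋀[ℂ]^(2 * k) ((ι × (K ≃ₐ[ℚ] K)) → ℂ)) =
      c • ratWeil K φ₀ e f := by
  rw [weilEquiv, LinearEquiv.trans_apply, LinearEquiv.coe_ofEq_apply, LinearEquiv.ofInjective_apply]
  show lineComb K φ₀ e (splitEquiv K (c ⊗ₜ[ℚ] f)) = c • ratWeil K φ₀ e f
  rw [ratWeil_eq_lineComb_splitEquiv, ← map_smul, ← map_smul, TensorProduct.smul_tmul', smul_eq_mul,
    mul_one]

omit [Fintype ι] in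
/-- `weilEquiv (1 ⊗ 1) = ratWeil 1 = Σ_g e_g`: the generator. -/
theorem coe_weilEquiv_one_tmul_one {k : ℕ} (hk : 0 < k) (e : Fin (2 * k) ≃ ι) :
    (weilEquiv K φ₀ hk e ((1 : ℂ) ⊗ₜ[ℚ] (1 : K)) : ⋀[ℂ]^(2 * k) ((ι × (K ≃ₐ[ℚ] K)) → ℂ)) =
      ∑ g : K ≃ₐ[ℚ] K, weilWedgeProd e g := by
  rw [coe_weilEquiv_tmul, one_smul, ratWeil_one]

/-! ### `ℚ`-linearity and injectivity: a `ℚ`-form of dimension `[K : ℚ]` -/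

omit [IsGalois ℚ K] [Fintype ι] in
/-- `ratWeil` is additive in `f`. -/
theorem ratWeil_add {k : ℕ} (e : Fin (2 * k) ≃ ι) (f f' : K) :
    ratWeil K φ₀ e (f + f') = ratWeil K φ₀ e f + ratWeil K φ₀ e f' := by
  simp only [ratWeil, map_add, add_smul, Finset.sum_add_distrib]

omit [IsGalois ℚ K] [Fintype ι] in
/-- `ratWeil` is `ℚ`-homogeneous in `f`: `ratWeil (q • f) = q • ratWeil f` (the scalar `q` read in `ℂ`). -/
theorem ratWeil_smul {k : ℕ} (e : Fin (2 * k) ≃ ι) (q : ℚ) (f : K) :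
    ratWeil K φ₀ e (q • f) = (q : ℂ) • ratWeil K φ₀ e f := by
  rw [ratWeil, ratWeil, Finset.smul_sum]
  refine Finset.sum_congr rfl fun g _ => ?_
  rw [Rat.smul_def, map_mul, map_ratCast, map_mul, map_ratCast, smul_smul]

omit [IsGalois ℚ K] [Fintype ι] in
/-- The coefficient of the `g`-line in `ratWeil φ₀ e f` is `φ₀ (g f)` (`k ≥ 1`). -/
theorem lineDual_ratWeil {k : ℕ} (hk : 0 < k) (e : Fin (2 * k) ≃ ι) (f : K) (g : K ≃ₐ[ℚ] K) :
    lineDual e g (ratWeil K φ₀ e f) = φ₀ (g f) := by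
  rw [ratWeil, map_sum, Finset.sum_eq_single g]
  · rw [map_smul, lineDual_weilWedgeProd_self, smul_eq_mul, mul_one]
  · intro g' _ hg'
    rw [map_smul, lineDual_weilWedgeProd_of_ne hk e (Ne.symm hg'), smul_zero]
  · intro h
    exact absurd (Finset.mem_univ g) h

omit [IsGalois ℚ K] [Fintype ι] in
/-- **`f ↦ ratWeil f` is injective** (`k ≥ 1`): the coefficient of the `1`-line is `φ₀ f`. -/
theorem ratWeil_injective {k : ℕ} (hk : 0 < k) (e : Fin (2 * k) ≃ ι) :
    Function.Injective (ratWeil K φ₀ e) := by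
  intro f f' h
  have := congrArg (lineDual e (1 : K ≃ₐ[ℚ] K)) h
  rw [lineDual_ratWeil K φ₀ hk, lineDual_ratWeil K φ₀ hk, AlgEquiv.one_apply, AlgEquiv.one_apply] at this
  exact φ₀.injective this

/-! ### The action of `K` on the Weil space: `f` scales the `g`-line by `σ_g(f)` -/

omit [IsGalois ℚ K] [Fintype ι] in
/-- The action of `f ∈ K` on `⋀^{2k} ℂ^{ι × G}` through `K ⊗ ℂ = ∏_σ ℂ`: the `g`-line is scaled by
`σ_g(f) = φ₀(g f)` (the operator is `Σ_g φ₀(g f) · (the projection onto the `g`-line)`, zero off the Weil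
space). -/
noncomputable def fieldAct {k : ℕ} (e : Fin (2 * k) ≃ ι) (f : K) :
    ⋀[ℂ]^(2 * k) ((ι × (K ≃ₐ[ℚ] K)) → ℂ) →ₗ[ℂ] ⋀[ℂ]^(2 * k) ((ι × (K ≃ₐ[ℚ] K)) → ℂ) :=
  ∑ g : K ≃ₐ[ℚ] K, (φ₀ (g f)) • (lineDual e g).smulRight (weilWedgeProd e g)

omit [IsGalois ℚ K] [Fintype ι] in
/-- `fieldAct f` scales the `g`-line by `φ₀ (g f)` (`k ≥ 1`). -/
theorem fieldAct_weilWedgeProd {k : ℕ} (hk : 0 < k) (e : Fin (2 * k) ≃ ι) (f : K) (g : K ≃ₐ[ℚ] K) :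
    fieldAct K φ₀ e f (weilWedgeProd e g) = φ₀ (g f) • weilWedgeProd e g := by
  simp only [fieldAct, LinearMap.sum_apply, LinearMap.smul_apply, LinearMap.smulRight_apply]
  rw [Finset.sum_eq_single g]
  · rw [lineDual_weilWedgeProd_self, one_smul]
  · intro g' _ hg'
    rw [lineDual_weilWedgeProd_of_ne hk e hg', zero_smul, smul_zero]
  · intro h
    exact absurd (Finset.mem_univ g) h

omit [IsGalois ℚ K] [Fintype ι] in
/-- **The `K`-module structure of the Weil space**: `fieldAct f (ratWeil f') = ratWeil (f f')` (`k ≥ 1`) — the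
rational Weil classes are a `K`-line `K · ratWeil 1`, with `K` acting through `σ_g` on the `g`-line. -/
theorem fieldAct_ratWeil {k : ℕ} (hk : 0 < k) (e : Fin (2 * k) ≃ ι) (f f' : K) :
    fieldAct K φ₀ e f (ratWeil K φ₀ e f') = ratWeil K φ₀ e (f * f') := by
  simp only [fieldAct, LinearMap.sum_apply, LinearMap.smul_apply, LinearMap.smulRight_apply,
    lineDual_ratWeil K φ₀ hk]
  simp only [ratWeil, map_mul, smul_smul]

/-! ### The Galois action changes the base embedding -/

omit [IsGalois ℚ K] [Fintype ι] in
/-- The model's Galois action `galProd k h` carries `ratWeil φ₀ e f` to `ratWeil (φ₀ ∘ h⁻¹) e f`: it acts on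
the CM-algebra side (`K ⊗ ℂ = ∏_σ ℂ`, permuting the factors `σ_g ↦ σ_{hg}`), i.e. changes the base
embedding, and leaves `f` alone. -/
theorem galProd_ratWeil {k : ℕ} (e : Fin (2 * k) ≃ ι) (h : K ≃ₐ[ℚ] K) (f : K) :
    galProd k h (ratWeil K φ₀ e f) = ratWeil K (φ₀.comp (h⁻¹ : K ≃ₐ[ℚ] K)) e f := by
  simp only [ratWeil, map_sum, map_smul, galProd_weilWedgeProd]
  refine (Fintype.sum_equiv (Equiv.mulLeft h) _ _ fun g => ?_)
  simp only [Equiv.coe_mulLeft, RingHom.comp_apply, RingHom.coe_coe, AlgEquiv.mul_apply,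
    AlgEquiv.aut_inv, AlgEquiv.symm_apply_apply]

end HodgeRepro.RouteC
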